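import Summits.CriticalPhenomena.PercolationContinuityZ3.Theorems.Transplant.FKDoubleFanTwoSidedConeS
import Summits.CriticalPhenomena.PercolationContinuityZ3.Theorems.Transplant.FKDoubleFanOneSidedConeSCross
import HarnessLib

/-!
# Double fans `K₂ ∨ P_{m+1}`: cross-positivity machinery for the TWO-SIDED relaxation cone, part A — the `T_a` resolvent, the compact
# generating set `atomClosure2`, full spokes by continuity

Helper file (`--supports stmt-CriticalPhenomena-4575`), FK sub-lane `prim-bschramm-fk-3` (gen 41); builds on p205010 (kernel theorem, internal
audit signed; external expert review pending).  No named facts, no sorries; standard axioms.  Memo `bschramm/prim-bschramm-fk-3/FAR-CROSS-XVI.md` §5.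
Part B (`…TwoSidedConeSCross`) assembles the exact criteria `hypAS_of_crossPos2` / `hypBS_of_crossPos2` from these pieces.

`…TwoSidedConeS` reduces the far cross-apex theorem for ALL middles to the two closure statements `HypAS q` ((CL-a)_S) and `HypBS q` ((CL-b)_S)
about the bi-dual `tsConeS q` of the two-sided images over `InS`.  As in `…OneSidedConeSCross` (gen 39, one-sided cone), both are EQUIVALENT to
first-order tangency conditions at the generators, because `∧²BC_y = (1−y)²·exp(s·T_b)` and `∧²AC_x = (1−x)²·exp(s·T_a)` are one-parameter
semigroups generated by the diagonal operators `T_b` (weights `0,1,2` on `{ux,uy,xy} / {uz,uv,xz,xv,yz,yv} / {zv}`) and `T_a` (weights `0,1,2` on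
`{ux,uz,xz} / {uy,uv,xy,xv,yz,zv} / {yv}`), and a closed convex cone is invariant under `exp(sT)`, `s ≥ 0`, iff `T` is CROSS-POSITIVE on it
(Schneider–Vidyasagar; elementary resolvent proof).  This file: the `T_a` half of the abstract machinery (**`scaleTa`**, **`pairH_scaleTa_right`**,
**`opAC_eq_scaleTa`**, **`res_sub_opTa`**, **`pdualA_of_sub`**, **`pdualA_res`**, **`pdualA_res_pow`**, **`pdualA_exp`**, **`pdual_opAC`**; the `T_b`
half is `…OneSidedConeSCross`, whose abstract lemmas are generic in the family); the compact generating set **`atomClosure2 q`** = closure in `ℝ¹⁰` of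
the normalised non-zero `a`-images AND `b`-images over `InS` (**`tsDualS_iff_atomClosure2`**: its half-space dual is `TSDualS q`;
**`ofFun_mem_tsConeS_of_mem_atomClosure2`**); and the full spokes by continuity (**`pairH_opAC_poly`**, **`opBC_one_mem_tsConeS_of_lt`**,
**`opAC_one_mem_tsConeS_of_lt`**).
[folklore]
-/

noncomputable section

open Filter Topology

namespace Summit.CriticalPhenomena.PercolationContinuityZ3.Theorems

namespace FK

namespace ThreeApex

/-! ### The diagonal operators on the three `T_a`-weight classes and the resolvent of `T_a` -/

/-- `diag(r, s, t)` on the `T_a`-weight classes: `r` on `ux, uz, xz` (weight 0), `s` on `uy, uv, xy, xv, yz, zv` (weight 1), `t` on `yv`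
(weight 2). [folklore] -/
def scaleTa (r s t : ℝ) (β : Biv) : Biv :=
  ⟨r * β.ux, s * β.uy, r * β.uz, s * β.uv, s * β.xy, r * β.xz, s * β.xv, s * β.yz, t * β.yv, s * β.zv⟩

/-- `diag(1,1,1) = id`. [folklore] -/
theorem scaleTa_one (β : Biv) : scaleTa 1 1 1 β = β := by
  ext <;> simp [scaleTa]

/-- The diagonal operators compose multiplicatively. [folklore] -/
theorem scaleTa_scaleTa (r s t r' s' t' : ℝ) (β : Biv) :
    scaleTa r s t (scaleTa r' s' t' β) = scaleTa (r * r') (s * s') (t * t') β := by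
  ext <;> simp [scaleTa] <;> ring

/-- Scalar multiples of a diagonal operator. [folklore] -/
theorem smul_scaleTa (c r s t : ℝ) (β : Biv) : Biv.smul c (scaleTa r s t β) = scaleTa (c * r) (c * s) (c * t) β := by
  ext <;> simp [scaleTa, Biv.smul] <;> ring

/-- The `T_a`-weight-0 part of the pairing. [folklore] -/
def pairA0 (q : ℝ) (β γ : Biv) : ℝ := (1 - q) ^ 2 * (2 - q) * (β.ux * γ.ux + β.uz * γ.uz) - (1 - q) ^ 2 * (β.xz * γ.xz)

/-- The `T_a`-weight-1 part of the pairing. [folklore] -/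
def pairA1 (q : ℝ) (β γ : Biv) : ℝ :=
  (1 - q) ^ 2 * (2 - q) * (β.uy * γ.uy) - (1 - q) * (2 - q) * β.uv * γ.uv - (1 - q) ^ 2 * (β.xy * γ.xy + β.yz * γ.yz)
    + (1 - q) * (β.xv * γ.xv + β.zv * γ.zv)

/-- The `T_a`-weight-2 part of the pairing. [folklore] -/
def pairA2 (q : ℝ) (β γ : Biv) : ℝ := (1 - q) * (β.yv * γ.yv)

/-- The pairing against `diag(r,s,t)ρ` is affine in `(r, s, t)`. [folklore] -/
theorem pairH_scaleTa_right (q r s t : ℝ) (β ρ : Biv) :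
    pairH q β (scaleTa r s t ρ) = r * pairA0 q β ρ + s * pairA1 q β ρ + t * pairA2 q β ρ := by
  simp only [pairH, scaleTa, pairA0, pairA1, pairA2]; ring

/-- `∧²AC_x = diag((1−x)², 1−x, 1)` on the `T_a`-weight classes. [folklore] -/
theorem opAC_eq_scaleTa (x : ℝ) (β : Biv) : opAC x β = scaleTa ((1 - x) ^ 2) (1 - x) 1 β := by
  ext <;> simp [opAC, opTa, opWa, Biv.lin3, Biv.add, Biv.smul, scaleTa] <;> ring

/-- **The resolvent identity for `T_a`**: `R_h ρ − h·T_a (R_h ρ) = ρ` for `R_h = diag(1, (1−h)⁻¹, (1−2h)⁻¹)`, `h ≠ 1, 1/2`. [folklore] -/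
theorem res_sub_opTa {h : ℝ} (h1 : 1 - h ≠ 0) (h2 : 1 - 2 * h ≠ 0) (ρ : Biv) :
    Biv.add (scaleTa 1 (1 - h)⁻¹ (1 - 2 * h)⁻¹ ρ) (Biv.smul (-h) (opTa (scaleTa 1 (1 - h)⁻¹ (1 - 2 * h)⁻¹ ρ))) = ρ := by
  ext <;> simp [scaleTa, opTa, Biv.add, Biv.smul] <;> field_simp <;> ring

/-- `⟪β, T_a ρ⟫ = ⟪T_a β, ρ⟫` in the orientation used below. [folklore] -/
theorem pairH_opTa_right (q : ℝ) (β ρ : Biv) : pairH q β (opTa ρ) = pairH q (opTa β) ρ := (pairH_opTa q β ρ).symm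

/-! ### The abstract variational step and its iteration for `T_a` -/

section AbstractA

variable {X : Type*} {q : ℝ} {P : Set X} {α : X → Biv}

variable {e₀ : Biv} {M : ℝ} (he : ∀ x ∈ P, 0 < pairH q (α x) e₀) (hM : ∀ x ∈ P, pairH q (α x) (opTa e₀) ≤ M * pairH q (α x) e₀)
  (hmin : ∀ ρ : Biv, (∃ x ∈ P, pairH q (α x) ρ < 0) →
    ∃ x₀ ∈ P, ∀ x ∈ P, pairH q (α x₀) ρ * pairH q (α x) e₀ ≤ pairH q (α x) ρ * pairH q (α x₀) e₀)
  (hcross : ∀ x ∈ P, ∀ ρ : Biv, PDual q P α ρ → pairH q (α x) ρ = 0 → 0 ≤ pairH q (opTa (α x)) ρ)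
include he hM hmin hcross

/-- **The variational step for `T_a`** (as `pdual_of_sub` for `T_b`): under the positivity functional `e₀`, the bound `⟪α x, T_a e₀⟫ ≤ M ⟪α x, e₀⟫`,
attained negative ratio minima and cross-positivity of `T_a`, if `ρ − h·T_a ρ` is in the dual (`0 < h`, `hM < 1`) then so is `ρ`. [folklore] -/
theorem pdualA_of_sub {h : ℝ} (hh : 0 < h) (hhM : h * M < 1) {ρ : Biv} (hρ : PDual q P α (Biv.add ρ (Biv.smul (-h) (opTa ρ)))) :
    PDual q P α ρ := by
  by_contra hneg
  simp only [PDual, not_forall, not_le] at hneg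
  obtain ⟨x₁, hx₁, hneg₁⟩ := hneg
  obtain ⟨x₀, hx₀, hmin₀⟩ := hmin ρ ⟨x₁, hx₁, hneg₁⟩
  set E := pairH q (α x₀) e₀ with hE
  set R := pairH q (α x₀) ρ with hR
  have hE0 : 0 < E := he x₀ hx₀
  have hR0 : R < 0 := by
    have h1 := hmin₀ x₁ hx₁
    have h2 : pairH q (α x₁) ρ * E < 0 := mul_neg_of_neg_of_pos hneg₁ hE0
    nlinarith [he x₁ hx₁]
  set ρ' : Biv := Biv.add ρ (Biv.smul (-(R / E)) e₀) with hρ'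
  have hρ'dual : PDual q P α ρ' := by
    intro x hx
    rw [hρ', pairH_add_right', pairH_smul_right']
    have h1 := hmin₀ x hx
    have : R / E * pairH q (α x) e₀ ≤ pairH q (α x) ρ := by
      rw [div_mul_eq_mul_div, div_le_iff₀ hE0]; linarith
    linarith
  have hρ'zero : pairH q (α x₀) ρ' = 0 := by
    rw [hρ', pairH_add_right', pairH_smul_right']; field_simp; ring
  have hcr := hcross x₀ hx₀ ρ' hρ'dual hρ'zero
  rw [hρ', pairH_add_right', pairH_smul_right'] at hcr
  have hsub := hρ x₀ hx₀
  rw [pairH_add_right', pairH_smul_right', pairH_opTa_right] at hsub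
  have hMe : pairH q (opTa (α x₀)) e₀ ≤ M * E := by rw [← pairH_opTa_right]; exact hM x₀ hx₀
  have hRE : R / E < 0 := div_neg_of_neg_of_pos hR0 hE0
  have h3 : R * M ≤ R / E * pairH q (opTa (α x₀)) e₀ := by
    have := mul_le_mul_of_nonpos_left hMe hRE.le
    calc R * M = R / E * (M * E) := by field_simp
      _ ≤ R / E * pairH q (opTa (α x₀)) e₀ := this
  have h4 : R * M ≤ pairH q (opTa (α x₀)) ρ := by linarith
  have h5 : h * pairH q (opTa (α x₀)) ρ ≤ R := by linarith
  have h6 : h * (R * M) ≤ R := le_trans (mul_le_mul_of_nonneg_left h4 hh.le) h5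
  nlinarith

/-- **Resolvent stability of the dual** for `T_a`: `ρ ∈ dual ⟹ R_h ρ ∈ dual` (`0 < h < 1/2`, `hM < 1`). [folklore] -/
theorem pdualA_res {h : ℝ} (hh : 0 < h) (hh2 : h < 1 / 2) (hhM : h * M < 1) {ρ : Biv} (hρ : PDual q P α ρ) :
    PDual q P α (scaleTa 1 (1 - h)⁻¹ (1 - 2 * h)⁻¹ ρ) := by
  have h1 : 1 - h ≠ 0 := by intro e; linarith
  have h2 : 1 - 2 * h ≠ 0 := by intro e; linarith
  refine pdualA_of_sub he hM hmin hcross hh hhM ?_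
  rw [res_sub_opTa h1 h2]; exact hρ

/-- Iterated `T_a`-resolvents: the dual is stable under `diag(1, (1−h)⁻ⁿ, (1−2h)⁻ⁿ)`. [folklore] -/
theorem pdualA_res_pow {h : ℝ} (hh : 0 < h) (hh2 : h < 1 / 2) (hhM : h * M < 1) {ρ : Biv} (hρ : PDual q P α ρ) (n : ℕ) :
    PDual q P α (scaleTa 1 ((1 - h)⁻¹ ^ n) ((1 - 2 * h)⁻¹ ^ n) ρ) := by
  induction n with
  | zero => simpa [scaleTa_one] using hρ
  | succ n ih =>
    have := pdualA_res he hM hmin hcross hh hh2 hhM ih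
    rw [scaleTa_scaleTa] at this
    simpa [pow_succ, mul_comm] using this

/-- **The exponential of `T_a`**: the dual is stable under `diag(1, eˢ, e²ˢ)` (on the `T_a`-weight classes) for every `s ≥ 0`. [folklore] -/
theorem pdualA_exp (hM0 : 0 < M) {s : ℝ} (hs : 0 ≤ s) {ρ : Biv} (hρ : PDual q P α ρ) :
    PDual q P α (scaleTa 1 (Real.exp s) (Real.exp (2 * s)) ρ) := by
  rcases hs.eq_or_lt with rfl | hs0
  · intro x hx; simpa [scaleTa_one] using hρ x hx
  intro x hx
  have hA : Tendsto (fun n : ℕ => ((1 + -s / (n : ℝ)) ^ n)⁻¹) atTop (𝓝 (Real.exp s)) := by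
    have := (Real.tendsto_one_add_div_pow_exp (-s)).inv₀ (Real.exp_pos _).ne'
    simpa [Real.exp_neg] using this
  have hB : Tendsto (fun n : ℕ => ((1 + -(2 * s) / (n : ℝ)) ^ n)⁻¹) atTop (𝓝 (Real.exp (2 * s))) := by
    have := (Real.tendsto_one_add_div_pow_exp (-(2 * s))).inv₀ (Real.exp_pos _).ne'
    simpa [Real.exp_neg] using this
  have hlim : Tendsto (fun n : ℕ => pairH q (α x) (scaleTa 1 (((1 + -s / (n : ℝ)) ^ n)⁻¹) (((1 + -(2 * s) / (n : ℝ)) ^ n)⁻¹) ρ))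
      atTop (𝓝 (pairH q (α x) (scaleTa 1 (Real.exp s) (Real.exp (2 * s)) ρ))) := by
    simp only [pairH_scaleTa_right]
    exact ((tendsto_const_nhds.add (hA.mul_const _)).add (hB.mul_const _))
  refine ge_of_tendsto hlim ?_
  have hsn : Tendsto (fun n : ℕ => s / (n : ℝ)) atTop (𝓝 0) := tendsto_const_div_atTop_nhds_zero_nat s
  have hev1 : ∀ᶠ n : ℕ in atTop, s / (n : ℝ) < min (1 / 2) (1 / M) :=
    (tendsto_order.1 hsn).2 _ (lt_min (by norm_num) (by positivity))
  have hev2 : ∀ᶠ n : ℕ in atTop, 0 < n := eventually_gt_atTop 0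
  filter_upwards [hev1, hev2] with n hn1 hn2
  have hnpos : (0 : ℝ) < n := by exact_mod_cast hn2
  have hh : 0 < s / (n : ℝ) := div_pos hs0 hnpos
  have hh2 : s / (n : ℝ) < 1 / 2 := lt_of_lt_of_le hn1 (min_le_left _ _)
  have hhM : s / (n : ℝ) * M < 1 := by
    have : s / (n : ℝ) < 1 / M := lt_of_lt_of_le hn1 (min_le_right _ _)
    rwa [lt_div_iff₀ hM0] at this
  have key := pdualA_res_pow he hM hmin hcross hh hh2 hhM hρ n x hx
  have e1 : (1 - s / (n : ℝ))⁻¹ ^ n = ((1 + -s / (n : ℝ)) ^ n)⁻¹ := by rw [inv_pow]; ring_nf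
  have e2 : (1 - 2 * (s / (n : ℝ)))⁻¹ ^ n = ((1 + -(2 * s) / (n : ℝ)) ^ n)⁻¹ := by rw [inv_pow]; ring_nf
  rwa [e1, e2] at key

/-- **`A`-stability of the dual**: under cross-positivity of `T_a` the dual is stable under every `∧²AC_x`, `x ∈ [0,1)`. [folklore] -/
theorem pdual_opAC (hM0 : 0 < M) {x : ℝ} (hx0 : 0 ≤ x) (hx1 : x < 1) {ρ : Biv} (hρ : PDual q P α ρ) :
    PDual q P α (opAC x ρ) := by
  have h1x : 0 < 1 - x := sub_pos.2 hx1
  set s : ℝ := -Real.log (1 - x) with hs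
  have hs0 : 0 ≤ s := by rw [hs, neg_nonneg]; exact Real.log_nonpos (sub_nonneg.2 hx1.le) (by linarith)
  have hexp : Real.exp s = (1 - x)⁻¹ := by rw [hs, Real.exp_neg, Real.exp_log h1x]
  have hexp2 : Real.exp (2 * s) = (1 - x)⁻¹ ^ 2 := by
    rw [← hexp, sq, ← Real.exp_add]; ring_nf
  have key := (pdualA_exp he hM hmin hcross hM0 hs0 hρ).smul (sq_nonneg (1 - x))
  rw [hexp, hexp2, smul_scaleTa] at key
  have e : opAC x ρ = scaleTa ((1 - x) ^ 2 * 1) ((1 - x) ^ 2 * (1 - x)⁻¹) ((1 - x) ^ 2 * (1 - x)⁻¹ ^ 2) ρ := by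
    rw [opAC_eq_scaleTa]; congr 1 <;> field_simp
  rw [e]; exact key

end AbstractA

/-! ### The instantiation: normalised `a`- AND `b`-images in `ℝ¹⁰` -/

/-- The set of normalised non-zero two-sided images `imgA q F w`, `imgB q G w` (`F, G, w ∈ InS q`), as coordinate vectors. [folklore] -/
def atomSet2 (q : ℝ) : Set (Fin 10 → ℝ) :=
  {v | ∃ F w : V5, InS q F ∧ InS q w ∧ Biv.toFun (imgA q F w) ≠ 0 ∧ v = ‖Biv.toFun (imgA q F w)‖⁻¹ • Biv.toFun (imgA q F w)} ∪
    {v | ∃ G w : V5, InS q G ∧ InS q w ∧ Biv.toFun (imgB q G w) ≠ 0 ∧ v = ‖Biv.toFun (imgB q G w)‖⁻¹ • Biv.toFun (imgB q G w)}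

/-- **The compact generating set of the two-sided cone**: the closure of the normalised two-sided images. [folklore] -/
def atomClosure2 (q : ℝ) : Set (Fin 10 → ℝ) := closure (atomSet2 q)

/-- The `a`-atoms are among the two-sided atoms. [folklore] -/
theorem atomSet_subset_atomSet2 (q : ℝ) : atomSet q ⊆ atomSet2 q := fun _ hv => Or.inl hv

/-- Normalised two-sided atoms lie in the closed unit ball. [folklore] -/
theorem atomSet2_subset_closedBall (q : ℝ) : atomSet2 q ⊆ Metric.closedBall 0 1 := by
  rintro v (⟨F, w, -, -, hne, rfl⟩ | ⟨G, w, -, -, hne, rfl⟩) <;>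
    rw [Metric.mem_closedBall, dist_zero_right, norm_smul, norm_inv, norm_norm, inv_mul_cancel₀ (norm_ne_zero_iff.2 hne)]

/-- `atomClosure2 q` is compact. [folklore] -/
theorem isCompact_atomClosure2 (q : ℝ) : IsCompact (atomClosure2 q) :=
  (isCompact_closedBall (0 : Fin 10 → ℝ) 1).of_isClosed_subset isClosed_closure
    (closure_minimal (atomSet2_subset_closedBall q) Metric.isClosed_closedBall)

/-- `atomClosure2 q` is nonempty (`0 < q ≤ 1`). [folklore] -/
theorem atomClosure2_nonempty {q : ℝ} (hq0 : 0 < q) (hq1 : q ≤ 1) : (atomClosure2 q).Nonempty :=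
  ((atomSet_nonempty hq0 hq1).mono (atomSet_subset_atomSet2 q)).mono subset_closure

/-- A closed half-space condition that holds on both atom families holds on the closure. [folklore] -/
theorem atomClosure2_le_of_atoms {q : ℝ} {ρ : Biv} {c : ℝ}
    (hA : ∀ F w : V5, InS q F → InS q w → c * ‖Biv.toFun (imgA q F w)‖ ≤ pairH q (imgA q F w) ρ)
    (hB : ∀ G w : V5, InS q G → InS q w → c * ‖Biv.toFun (imgB q G w)‖ ≤ pairH q (imgB q G w) ρ) :
    ∀ v ∈ atomClosure2 q, c ≤ pairH q (Biv.ofFun v) ρ := by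
  have hcl : IsClosed {v : Fin 10 → ℝ | c ≤ pairH q (Biv.ofFun v) ρ} := isClosed_le continuous_const (continuous_pairH_ofFun q ρ)
  refine fun v hv => closure_minimal ?_ hcl hv
  rintro v (⟨F, w, hF, hw, hne, rfl⟩ | ⟨G, w, hG, hw, hne, rfl⟩)
  · have hn : 0 < ‖Biv.toFun (imgA q F w)‖ := norm_pos_iff.2 hne
    show c ≤ pairH q (Biv.ofFun (‖Biv.toFun (imgA q F w)‖⁻¹ • Biv.toFun (imgA q F w))) ρ
    rw [Biv.ofFun_smul, pairH_smul_left, Biv.ofFun_toFun, le_inv_mul_iff₀ hn]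
    simpa [mul_comm] using hA F w hF hw
  · have hn : 0 < ‖Biv.toFun (imgB q G w)‖ := norm_pos_iff.2 hne
    show c ≤ pairH q (Biv.ofFun (‖Biv.toFun (imgB q G w)‖⁻¹ • Biv.toFun (imgB q G w))) ρ
    rw [Biv.ofFun_smul, pairH_smul_left, Biv.ofFun_toFun, le_inv_mul_iff₀ hn]
    simpa [mul_comm] using hB G w hG hw

/-- **The half-space dual of `atomClosure2 q` is `TSDualS q`.** [folklore] -/
theorem tsDualS_iff_atomClosure2 (q : ℝ) (ρ : Biv) :
    TSDualS q ρ ↔ PDual q (atomClosure2 q) (fun v => Biv.ofFun v) ρ := by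
  constructor
  · intro hρ v hv
    have := atomClosure2_le_of_atoms (q := q) (ρ := ρ) (c := 0) (fun F w hF hw => by simpa using hρ.1 F w hF hw)
      (fun G w hG hw => by simpa using hρ.2 G w hG hw) v hv
    simpa using this
  · intro h
    refine ⟨fun F w hF hw => ?_, fun G w hG hw => ?_⟩
    · by_cases hne : Biv.toFun (imgA q F w) = 0
      · have e : imgA q F w = Biv.ofFun 0 := by rw [← hne, Biv.ofFun_toFun]
        rw [e, pairH_ofFun_zero]
      · have hn : 0 < ‖Biv.toFun (imgA q F w)‖ := norm_pos_iff.2 hne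
        have hv : ‖Biv.toFun (imgA q F w)‖⁻¹ • Biv.toFun (imgA q F w) ∈ atomClosure2 q :=
          subset_closure (Or.inl ⟨F, w, hF, hw, hne, rfl⟩)
        have := h _ hv
        dsimp only at this
        rw [Biv.ofFun_smul, pairH_smul_left, Biv.ofFun_toFun] at this
        exact (mul_nonneg_iff_of_pos_left (inv_pos.2 hn)).1 this
    · by_cases hne : Biv.toFun (imgB q G w) = 0
      · have e : imgB q G w = Biv.ofFun 0 := by rw [← hne, Biv.ofFun_toFun]
        rw [e, pairH_ofFun_zero]
      · have hn : 0 < ‖Biv.toFun (imgB q G w)‖ := norm_pos_iff.2 hne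
        have hv : ‖Biv.toFun (imgB q G w)‖⁻¹ • Biv.toFun (imgB q G w) ∈ atomClosure2 q :=
          subset_closure (Or.inr ⟨G, w, hG, hw, hne, rfl⟩)
        have := h _ hv
        dsimp only at this
        rw [Biv.ofFun_smul, pairH_smul_left, Biv.ofFun_toFun] at this
        exact (mul_nonneg_iff_of_pos_left (inv_pos.2 hn)).1 this

/-- Points of the closure lie in the (closed) cone `tsConeS q`. [folklore] -/
theorem ofFun_mem_tsConeS_of_mem_atomClosure2 {q : ℝ} {v : Fin 10 → ℝ} (hv : v ∈ atomClosure2 q) : Biv.ofFun v ∈ tsConeS q :=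
  fun γ hγ => (tsDualS_iff_atomClosure2 q γ).1 hγ v hv

/-! ### Full spokes by continuity -/

/-- `⟪∧²AC_x β, γ⟫` as a quadratic polynomial in `x`. [folklore] -/
theorem pairH_opAC_poly (q x : ℝ) (β γ : Biv) :
    pairH q (opAC x β) γ = (1 - x) ^ 2 * pairH q β γ + x * (1 - x) * pairH q (opTa β) γ + x ^ 2 * pairH q (opWa β) γ := by
  rw [opAC, pairH_lin3_left]

/-- **The full `b`-spoke by continuity** in `tsConeS`. [folklore] -/
theorem opBC_one_mem_tsConeS_of_lt {q : ℝ} {β : Biv} (hβ : ∀ y : ℝ, 0 ≤ y → y < 1 → opBC y β ∈ tsConeS q) :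
    opBC 1 β ∈ tsConeS q := by
  intro γ hγ
  set g : ℝ → ℝ := fun y => (1 - y) ^ 2 * pairH q β γ + y * (1 - y) * pairH q (opTb β) γ + y ^ 2 * pairH q (opWb β) γ with hg
  have hcont : Continuous g := by rw [hg]; continuity
  have hlim : Tendsto g (𝓝[<] (1 : ℝ)) (𝓝 (g 1)) := (hcont.tendsto 1).mono_left nhdsWithin_le_nhds
  have hev : ∀ᶠ y in 𝓝[<] (1 : ℝ), 0 ≤ g y := by
    filter_upwards [Ioo_mem_nhdsLT (zero_lt_one' ℝ)] with y hy
    rw [hg]; dsimp only; rw [← pairH_opBC_poly]; exact hβ y hy.1.le hy.2 γ hγ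
  have := ge_of_tendsto hlim hev
  rw [hg] at this; dsimp only at this
  rwa [pairH_opBC_poly]

/-- **The full `a`-spoke by continuity** in `tsConeS`. [folklore] -/
theorem opAC_one_mem_tsConeS_of_lt {q : ℝ} {β : Biv} (hβ : ∀ x : ℝ, 0 ≤ x → x < 1 → opAC x β ∈ tsConeS q) :
    opAC 1 β ∈ tsConeS q := by
  intro γ hγ
  set g : ℝ → ℝ := fun x => (1 - x) ^ 2 * pairH q β γ + x * (1 - x) * pairH q (opTa β) γ + x ^ 2 * pairH q (opWa β) γ with hg
  have hcont : Continuous g := by rw [hg]; continuity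
  have hlim : Tendsto g (𝓝[<] (1 : ℝ)) (𝓝 (g 1)) := (hcont.tendsto 1).mono_left nhdsWithin_le_nhds
  have hev : ∀ᶠ x in 𝓝[<] (1 : ℝ), 0 ≤ g x := by
    filter_upwards [Ioo_mem_nhdsLT (zero_lt_one' ℝ)] with x hx
    rw [hg]; dsimp only; rw [← pairH_opAC_poly]; exact hβ x hx.1.le hx.2 γ hγ
  have := ge_of_tendsto hlim hev
  rw [hg] at this; dsimp only at this
  rwa [pairH_opAC_poly]

end ThreeApex

end FK

end Summit.CriticalPhenomena.PercolationContinuityZ3.Theorems
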